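import Literature.MathematicalPhysics.QuantumFieldTheory.Balaban1983to89.B9Ineq369CurvatureSmall

/-!
# `Balaban1983to89.B9Ineq369CurvatureOperatorBound` — T. Bałaban, *Propagators for lattice gauge theories in a background field*, Commun.
# Math. Phys. **99** (1985) 389–434 [Balaban1985BackgroundPropagators] p. 392 *«the operator Δ′ will be a bounded, small operator»* / (3.69)
# p. 404: THE CURVATURE PART `Δ′(U)` OF THE HESSIAN (3.10) IS `O(ε)`-SMALL IN OPERATOR NORM on the pub-balaban NE9 chain's `L²` bond space —
# `‖Δ′(U)x‖ ≤ 32d·C_τ·M_φ²·(η^d/c₀)·(η⁻²ε)·‖x‖` when every plaquette holonomy is `ε`-close to `1` (the quadratic-form bound of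
# `B9Ineq369CurvatureSmall` polarised)

statement-level skeleton of published theorems with citation tags; proofs where landed; nothing here is a claim about the Yang–Mills mass gap

PDF held: `paper:balaban1985-cmp99-background-propagators` (journal page = PDF page + 388), pp. 392, 404 read by this seat (2026-08-22).

THE PRINT (verbatim).  p. 392, after (3.10): *«We have written it this way because with our assumptions on the configuration U the operator Δ′
will be a bounded, small operator, which will be treated as a small perturbation of D*D.»*  p. 404, (3.69): *«|(Δ′(U′U)A′)(b)| ≤ O(1)(L^jα₀ +
α₁)(L^jη)⁻² sup |A′(b′)|»*.

WHY THIS FILE (cell context).  `B9Ineq369CurvatureSmall.norm_inner_curvOp_self_le` (NE9 owner gen 78) bounds the QUADRATIC FORM `|⟨x, Δ′(U)x⟩|`,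
enough for positivity (`B9Thm311SmallFieldClosed`, gen 80).  The next owner target — UNIFORM bounds of `G₁(U)`, `H₁(U) = G₁Q†(QG₁Q†)⁻¹`, `𝔊(U)`
over the small-field set (uniform chart radii for the `cur U` species) — needs an OPERATOR bound of the assembled `Δ_a(U)`, hence of `Δ′(U)`
(`‖z‖ = ‖Δ_a w‖ ≤ M_Δ‖w‖` enters the lower bound of `QG₁Q†`).  This file polarises gen 78's argument: Cauchy–Schwarz over the plaquettes instead of
squares.

WHAT IS PROVED (sorry-free; no `Prop` placeholder; no inequality of the paper asserted as a hypothesis-free fact).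
* `sum_edgeSum_sq_le` (`Σ_p (Σ_{∂p}‖X‖)² ≤ 16d·M_φ²·‖x‖²/c₀` — gen 78's incidence steps, exported), **`norm_inner_curvOp_le`** (`‖⟨y, Δ′(U)x⟩‖ ≤
  32d·C_τ·M_φ²·(|η|^d/c₀)·η⁻²ε·‖x‖‖y‖`), **`norm_curvOp_le`** (`‖Δ′(U)x‖ ≤ 32d·C_τ·M_φ²·(|η|^d/c₀)·η⁻²ε·‖x‖`, with `y := Δ′(U)x`).
MODEL / DECLARED READINGS.  (M1)/(M2) as `B9Ineq369CurvatureSmall` (unit-bounded bond variables with unit-bounded inverses, plaquette holonomies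
`ε`-close to `1`, `‖τX‖ ≤ C_τ‖X‖`, `‖φw‖ ≤ M_φ‖w‖`, isometric star).  (M3) the constant is gen 78's witness for print's `O(1)` (crude); the local
(sup-norm) form (3.69) is lit-balaban's `B9Eq310Hermitian`, not restated.
HONEST SCOPE.  An elementary polarisation; NOT summit progress (cell pub-balaban: NE9 NOT PRINTED / NOT PROVED; spine PROVED 0/9).  Filed by the
pub-balaban NE9 BINDER-row owner lineage `b2b-balaban-t4-ne9-p1` (gen 80); NEW file importing `B9Ineq369CurvatureSmall` only; nothing modified.
Net new unproved facts: 0.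
-/

noncomputable section

open scoped InnerProductSpace ComplexConjugate BigOperators
open Finset

namespace Literature.MathematicalPhysics.QuantumFieldTheory.Balaban1983to89.B9Ineq369CurvatureOperatorBound

open B9SectCLatticeCarrier (Bond)
open B4Sect5Torus (TSite)
open B9Eq311L2Pairing (WL2)
open B9Eq310DeltaPrime (plaqHolU curvForm)
open B9Eq310HessianOperator (toAlg curvOp inner_curvOp)
open B11Eq103H1Complex (BondL2K)
open B9Ineq369CurvatureSmall (edgeBond edgeSum edgeSum_nonneg sum_edge_le norm_curvForm_le)

variable {d : ℕ} {Pd : Fin d → ℕ}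
  {𝔸 : Type*} [NormedRing 𝔸] [NormedAlgebra ℂ 𝔸] [StarRing 𝔸] [NormedStarGroup 𝔸] [StarModule ℂ 𝔸]
  {W : Type*} [NormedAddCommGroup W] [InnerProductSpace ℂ W] [FiniteDimensional ℂ W] (φ : W ≃ₗ[ℂ] 𝔸) {c₀ : ℝ} [Fact (0 < c₀)]
  {τ : 𝔸 →ₗ[ℂ] ℂ} {Cτ : ℝ} (hτ : ∀ X, ‖τ X‖ ≤ Cτ * ‖X‖) (hCτ : 0 ≤ Cτ) {Mφ : ℝ} (hφ : ∀ w, ‖φ w‖ ≤ Mφ * ‖w‖) (η : ℝ)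
  {U : Bond d Pd → 𝔸ˣ} (hU : ∀ b, ‖(U b : 𝔸)‖ ≤ 1 ∧ ‖(((U b)⁻¹ : 𝔸ˣ) : 𝔸)‖ ≤ 1) {ε : ℝ}
  (hpl : ∀ p : B9SectCLatticeCarrier.Plaq d Pd, ‖(plaqHolU U p : 𝔸) - 1‖ ≤ ε)

omit [NormedAlgebra ℂ 𝔸] [StarRing 𝔸] [NormedStarGroup 𝔸] [StarModule ℂ 𝔸] [FiniteDimensional ℂ W] in
/-- `Σ_p (Σ_{∂p}‖X‖)² ≤ 16d·M_φ²·‖x‖²/c₀` for `X = φ ∘ x` (or its star): the edge-sum energy of an `L²` bond function (CS over the four edges +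
the `4d` incidence count). [cite: Balaban1985BackgroundPropagators, (3.69) p.404, (3.11) p.392] -/
theorem sum_edgeSum_sq_le {Mφ : ℝ} (x : BondL2K ℂ d Pd c₀ W) (X : Bond d Pd → 𝔸) (hX : ∀ b, ‖X b‖ ≤ Mφ * ‖WL2.equiv ℂ _ W x b‖) :
    ∑ p : B9SectCLatticeCarrier.Plaq d Pd, edgeSum p X ^ 2 ≤ 16 * d * Mφ ^ 2 * (‖x‖ ^ 2 / c₀) := by
  have hc₀ : 0 < c₀ := Fact.out
  have hsq : ∀ p : B9SectCLatticeCarrier.Plaq d Pd, edgeSum p X ^ 2 ≤ 4 * ∑ k : Fin 4, ‖X (edgeBond p k)‖ ^ 2 := fun p => by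
    have h := sq_sum_le_card_mul_sum_sq (s := (univ : Finset (Fin 4))) (f := fun k => ‖X (edgeBond p k)‖)
    simpa using h
  have h2 : ∑ p : B9SectCLatticeCarrier.Plaq d Pd, edgeSum p X ^ 2 ≤ 4 * (4 * d) * ∑ b : Bond d Pd, ‖X b‖ ^ 2 := by
    calc ∑ p : B9SectCLatticeCarrier.Plaq d Pd, edgeSum p X ^ 2 ≤ ∑ p : B9SectCLatticeCarrier.Plaq d Pd, 4 * ∑ k : Fin 4, ‖X (edgeBond p k)‖ ^ 2 :=
          sum_le_sum fun p _ => hsq p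
      _ = 4 * ∑ pk : B9SectCLatticeCarrier.Plaq d Pd × Fin 4, ‖X (edgeBond pk.1 pk.2)‖ ^ 2 := by
          rw [← mul_sum]; congr 1
          exact (Fintype.sum_prod_type (fun pk : B9SectCLatticeCarrier.Plaq d Pd × Fin 4 => ‖X (edgeBond pk.1 pk.2)‖ ^ 2)).symm
      _ ≤ 4 * (4 * d * ∑ b : Bond d Pd, ‖X b‖ ^ 2) :=
          mul_le_mul_of_nonneg_left (sum_edge_le (g := fun b => ‖X b‖ ^ 2) fun b => sq_nonneg _) (by norm_num)
      _ = 4 * (4 * d) * ∑ b : Bond d Pd, ‖X b‖ ^ 2 := by ring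
  have h3 : ∑ b : Bond d Pd, ‖X b‖ ^ 2 ≤ Mφ ^ 2 * (‖x‖ ^ 2 / c₀) := by
    have hn : ‖x‖ ^ 2 = ∑ b : Bond d Pd, c₀ * ‖WL2.equiv ℂ _ W x b‖ ^ 2 := WL2.norm_sq x
    have hsum : ‖x‖ ^ 2 / c₀ = ∑ b : Bond d Pd, ‖WL2.equiv ℂ _ W x b‖ ^ 2 := by
      rw [hn, ← mul_sum, mul_div_cancel_left₀ _ hc₀.ne']
    rw [hsum, mul_sum]
    refine sum_le_sum fun b _ => ?_
    calc ‖X b‖ ^ 2 ≤ (Mφ * ‖WL2.equiv ℂ _ W x b‖) ^ 2 := by have := hX b; gcongr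
      _ = Mφ ^ 2 * ‖WL2.equiv ℂ _ W x b‖ ^ 2 := by ring
  calc ∑ p : B9SectCLatticeCarrier.Plaq d Pd, edgeSum p X ^ 2 ≤ 4 * (4 * d) * ∑ b : Bond d Pd, ‖X b‖ ^ 2 := h2
    _ ≤ 4 * (4 * d) * (Mφ ^ 2 * (‖x‖ ^ 2 / c₀)) := mul_le_mul_of_nonneg_left h3 (by positivity)
    _ = 16 * d * Mφ ^ 2 * (‖x‖ ^ 2 / c₀) := by ring

include hτ hCτ hφ hU hpl in
/-- **THE BILINEAR FORM OF `Δ′(U)` IS SMALL**: `‖⟪y, Δ′(U)x⟫‖ ≤ 32d·C_τ·M_φ²·(|η|^d/c₀)·η⁻²·ε·‖x‖·‖y‖` — `B9Ineq369CurvatureSmall.norm_inner_curvOp_self_le`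
polarised (Cauchy–Schwarz over the plaquettes instead of squares). [cite: Balaban1985BackgroundPropagators, p.392, (3.69) p.404] -/
theorem norm_inner_curvOp_le (hMφ : 0 ≤ Mφ) (hε : 0 ≤ ε) (y x : BondL2K ℂ d Pd c₀ W) :
    ‖⟪y, curvOp φ τ η U x⟫_ℂ‖ ≤ 32 * d * Cτ * Mφ ^ 2 * (|η| ^ d / c₀) * (‖((η : ℂ))⁻¹‖ ^ 2 * ε) * ‖x‖ * ‖y‖ := by
  have hc₀ : 0 < c₀ := Fact.out
  rw [inner_curvOp]
  have hstar : ∀ p, edgeSum p (star (toAlg φ y)) = edgeSum p (toAlg φ y) :=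
    fun p => sum_congr rfl fun k _ => by rw [Pi.star_apply, norm_star]
  have h1 : ‖curvForm τ η U (star (toAlg φ y)) (toAlg φ x)‖ ≤
      2 * Cτ * ε * |η| ^ d * ‖((η : ℂ))⁻¹‖ ^ 2 * ∑ p : B9SectCLatticeCarrier.Plaq d Pd, edgeSum p (toAlg φ y) * edgeSum p (toAlg φ x) := by
    refine (norm_curvForm_le hU hτ η hCτ hpl _ _).trans (le_of_eq ?_)
    congr 1
    exact sum_congr rfl fun p _ => by rw [hstar]
  -- Cauchy–Schwarz over the plaquettes
  have hCS : ∑ p : B9SectCLatticeCarrier.Plaq d Pd, edgeSum p (toAlg φ y) * edgeSum p (toAlg φ x) ≤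
      Real.sqrt (∑ p : B9SectCLatticeCarrier.Plaq d Pd, edgeSum p (toAlg φ y) ^ 2) * Real.sqrt (∑ p : B9SectCLatticeCarrier.Plaq d Pd, edgeSum p (toAlg φ x) ^ 2) := by
    have h := Real.sum_mul_le_sqrt_mul_sqrt (univ : Finset (B9SectCLatticeCarrier.Plaq d Pd)) (fun p => edgeSum p (toAlg φ y)) (fun p => edgeSum p (toAlg φ x))
    simpa using h
  have hy := sum_edgeSum_sq_le y (toAlg φ y) (fun b => hφ _)
  have hx := sum_edgeSum_sq_le x (toAlg φ x) (fun b => hφ _)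
  -- `√(Σ edgeSum²) ≤ 4√d·M_φ·‖·‖/√c₀`
  have hsd : Real.sqrt d ^ 2 = d := Real.sq_sqrt (Nat.cast_nonneg d)
  have hsc : Real.sqrt c₀ ^ 2 = c₀ := Real.sq_sqrt hc₀.le
  have hsc0 : 0 < Real.sqrt c₀ := Real.sqrt_pos.2 hc₀
  have hroot : ∀ (z : BondL2K ℂ d Pd c₀ W), ∑ p : B9SectCLatticeCarrier.Plaq d Pd, edgeSum p (toAlg φ z) ^ 2 ≤ 16 * d * Mφ ^ 2 * (‖z‖ ^ 2 / c₀) →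
      Real.sqrt (∑ p : B9SectCLatticeCarrier.Plaq d Pd, edgeSum p (toAlg φ z) ^ 2) ≤ 4 * Real.sqrt d * Mφ * ‖z‖ / Real.sqrt c₀ := fun z hz => by
    have ha : 0 ≤ 4 * Real.sqrt d * Mφ * ‖z‖ / Real.sqrt c₀ := by positivity
    have hsq : (4 * Real.sqrt d * Mφ * ‖z‖ / Real.sqrt c₀) ^ 2 = 16 * d * Mφ ^ 2 * (‖z‖ ^ 2 / c₀) := by
      rw [div_pow, show (4 * Real.sqrt d * Mφ * ‖z‖) ^ 2 = 16 * Real.sqrt d ^ 2 * Mφ ^ 2 * ‖z‖ ^ 2 by ring, hsd, hsc]; ring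
    calc Real.sqrt (∑ p : B9SectCLatticeCarrier.Plaq d Pd, edgeSum p (toAlg φ z) ^ 2) ≤ Real.sqrt ((4 * Real.sqrt d * Mφ * ‖z‖ / Real.sqrt c₀) ^ 2) :=
          Real.sqrt_le_sqrt (by rw [hsq]; exact hz)
      _ = 4 * Real.sqrt d * Mφ * ‖z‖ / Real.sqrt c₀ := Real.sqrt_sq ha
  have hprod : ∑ p : B9SectCLatticeCarrier.Plaq d Pd, edgeSum p (toAlg φ y) * edgeSum p (toAlg φ x) ≤
      (4 * Real.sqrt d * Mφ * ‖y‖ / Real.sqrt c₀) * (4 * Real.sqrt d * Mφ * ‖x‖ / Real.sqrt c₀) :=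
    hCS.trans (mul_le_mul (hroot y hy) (hroot x hx) (Real.sqrt_nonneg _) (by positivity))
  have hA : 0 ≤ 2 * Cτ * ε * |η| ^ d * ‖((η : ℂ))⁻¹‖ ^ 2 := by positivity
  calc ‖curvForm τ η U (star (toAlg φ y)) (toAlg φ x)‖
      ≤ 2 * Cτ * ε * |η| ^ d * ‖((η : ℂ))⁻¹‖ ^ 2 * ∑ p : B9SectCLatticeCarrier.Plaq d Pd, edgeSum p (toAlg φ y) * edgeSum p (toAlg φ x) := h1
    _ ≤ 2 * Cτ * ε * |η| ^ d * ‖((η : ℂ))⁻¹‖ ^ 2 * ((4 * Real.sqrt d * Mφ * ‖y‖ / Real.sqrt c₀) * (4 * Real.sqrt d * Mφ * ‖x‖ / Real.sqrt c₀)) :=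
        mul_le_mul_of_nonneg_left hprod hA
    _ = 32 * d * Cτ * Mφ ^ 2 * (|η| ^ d / c₀) * (‖((η : ℂ))⁻¹‖ ^ 2 * ε) * ‖x‖ * ‖y‖ := by
        rw [show (4 * Real.sqrt d * Mφ * ‖y‖ / Real.sqrt c₀) * (4 * Real.sqrt d * Mφ * ‖x‖ / Real.sqrt c₀) =
          16 * Real.sqrt d ^ 2 * Mφ ^ 2 * ‖x‖ * ‖y‖ / Real.sqrt c₀ ^ 2 by rw [div_mul_div_comm]; ring, hsd, hsc]
        ring

include hτ hCτ hφ hU hpl in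
/-- **`Δ′(U)` IS A SMALL OPERATOR ON THE `L²` BOND SPACE**: `‖Δ′(U)x‖ ≤ 32d·C_τ·M_φ²·(|η|^d/c₀)·η⁻²·ε·‖x‖` — the operator-norm form of print's
«Δ′ will be a bounded, small operator» (p. 392) ∕ (3.69), from the bilinear bound with `y := Δ′(U)x`. [cite: Balaban1985BackgroundPropagators, p.392, (3.69) p.404] -/
theorem norm_curvOp_le (hMφ : 0 ≤ Mφ) (hε : 0 ≤ ε) (x : BondL2K ℂ d Pd c₀ W) :
    ‖curvOp φ τ η U x‖ ≤ 32 * d * Cτ * Mφ ^ 2 * (|η| ^ d / c₀) * (‖((η : ℂ))⁻¹‖ ^ 2 * ε) * ‖x‖ := by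
  have hc₀ : 0 < c₀ := Fact.out
  have h1 : ‖curvOp φ τ η U x‖ ^ 2 ≤ 32 * d * Cτ * Mφ ^ 2 * (|η| ^ d / c₀) * (‖((η : ℂ))⁻¹‖ ^ 2 * ε) * ‖x‖ * ‖curvOp φ τ η U x‖ := by
    rw [← inner_self_eq_norm_sq (𝕜 := ℂ)]
    exact (RCLike.re_le_norm _).trans (norm_inner_curvOp_le φ hτ hCτ hφ η hU hpl hMφ hε _ x)
  rcases eq_or_lt_of_le (norm_nonneg (curvOp φ τ η U x)) with h0 | hpos
  · rw [← h0]; positivity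
  · have : ‖curvOp φ τ η U x‖ * ‖curvOp φ τ η U x‖ ≤ (32 * d * Cτ * Mφ ^ 2 * (|η| ^ d / c₀) * (‖((η : ℂ))⁻¹‖ ^ 2 * ε) * ‖x‖) * ‖curvOp φ τ η U x‖ := by
      nlinarith
    exact le_of_mul_le_mul_right this hpos

end Literature.MathematicalPhysics.QuantumFieldTheory.Balaban1983to89.B9Ineq369CurvatureOperatorBound

end
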